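import Summits.BirchSwinnertonDyer.BirchSwinnertonDyer.Theorems.KatoDescentTamePotSupersingularTameUpperOptimalSharpRoad
import Summits.BirchSwinnertonDyer.BirchSwinnertonDyer.Theorems.SmallImageMuTransferMuTransferStubCm
import Summits.BirchSwinnertonDyer.Rank1Residual.X12.InertCoreEveryCurve
import Summits.BirchSwinnertonDyer.Rank1Residual.GaloisImage.TorsionIsoImageObstruction
import Summits.BirchSwinnertonDyer.Rank1Residual.O6.X3WildOfKMCTorsionFreeMember
import Literature.NumberTheory.EllipticCurves.IsogenyQuadraticTwistProofs
import HarnessLib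

/-!
# Route `KatoDescentTamePotSupersingular` (rung K8, sub-rung B4 (t′), cell `bsd-potss`): the BODY of the U₀-ns
# node `TameUpperNonsurjTower` (item 19202) THROUGH THE OPTIMAL MEMBER OF THE CLASS — the ♯ rows from the
# displayed Jetchev reading of `…TameUpperOptimalSharpRoad`, Coates–Sujatha's (A) load-bearing only on the
# RESIDUE classes (Manin-dirty optimal member, or two Tamagawa-`p` primes); route-free (seat `bsd-potss-k8t-c4`
# g7); nothing booked, no item closed, BSD is not proved by any of this

THE RE-CUT of g6's node (p471788, `hJ` at the row in product form for any Manin-clean datum; (A) on the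
Manin-dirty rows): the two displayed inputs become

* `hJr` — the Jetchev irreducible reading of the prequel (optimal datum with `p ∤ c`, `p`-primary `Ш`, ONE
  Tamagawa prime `q ≠ p`; additive potentially good `p`, rank `0`, non-CM, `E[p]` irreducible, `ρ̄` not onto);
* `hCS` — Coates–Sujatha's (A) on the RESIDUE rows: non-CM (t′) rank-`0` rows `W` at odd `p` (`E[p]` irreducible,
  `ρ̄` not onto) whose class has an optimal member `W₀` (lattice-optimal datum `D₀` at level `N_E`,
  `X12.exists_isIsogenous_optimal`) with `p ∣ c(D₀)` (Manin-dirty; census-empty by Cremona's `c = 1`, `N ≤ 5·10⁵`)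
  or with the `p`-part of `∏c_ℓ(W₀)` carried by no single bad prime `q ≠ p` (census: 3 of the 90 ♯ rows —
  130095bp1 @3, 470304m1 @3, 283200gf1 @5 —, where only Jetchev's Conj. 1.3 or (A) would serve).

THE ROAD (`upperNonsurjTower_of_jetchevReading_of_cruxAResidue`, conclusion = the BODY of 19202): at a row `W`
— CM → Burungale–Flach; `ρ̄` onto → void (tame tower at `3` / Serre at `p ≥ 5`); otherwise take the OPTIMAL
member `W₀ ∼ W` with its lattice-optimal datum `D₀` (Modularity alone); residue rows → the fine-Selmer port of
Kato 14.5 (3) + (A) AT `W`; else the prequel AT `W₀`: `r_an`, additivity with integral `j`, CM-ness,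
irreducibility and non-surjectivity move along the isogeny (`analyticRank_eq_of_isIsogenous'`,
`Additive.Addv.of_isIsogenous_of_padicValRat_j_nonneg`, `X12.hasCM_iff_of_isIsogenous`, the `Γ_ℚ`-isomorphism
`E[p] ≃ E₀[p]` of `exists_torsionIso_of_isIsogenous_of_irreducible` with
`GaloisImage.irr_and_not_surj_of_torsionIso`); `#Ш_an ∈ ℚ` (from the L₀ body AT `W`) and the twists' lower
halves (from `TameRankOne` at the minimal model of `E^{(d_K)}`, which IS a (t′) row — §1) are CARRIED to `W₀`
by Cassels' isogeny invariance (`X12.exists_shaAn_eq_of_isIsogenous`, `X12.missingLowerBoundAt_of_isIsogenous`;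
twists of isogenous curves are isogenous, `IsIsogenous.quadraticTwist`, Cremona §3.9); and the upper half
comes back from `W₀` to `W` by Cassels again (`X12.missingUpperBoundAt_of_isIsogenous`). NO (t′)-transport along
the isogeny is used (the tree has it at `p ≥ 5` only, `TameDefectIsogenyInvariance`), so `p = 3` is covered.

What this buys (planner g18 R141 / director-bsd R100c, evidence level until the D-audit returns): the (H♯)
input of the U₀-ns node is LITERALLY the cor15-shaped reading, and (A) (crux 19413 `TameFineSelmerCoatesSujatha`)
is load-bearing exactly on the {Manin-dirty} ∪ {multi-Tamagawa} classes. Inputs otherwise as in p471788 —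
the BODIES of L₀ (19981), `TameRankOne` (19984), `KatoTamagawaExactInputs` (19191; A161″ unused),
`PublishedInputsFineSelmerCM` (19387); Gross–Zagier, Kolyvagin, Matar–Nekovář, newforms,
Bump–Friedberg–Hoffstein — plus Cassels (`bsdRHS_eq_of_isIsogenous`, held). Conditional throughout; nothing
asserted; NO item closed; BSD is NOT proved by any of this.

References: [Jetchev2008] Hyp. (∗), Thm. 1.4, Cor. 1.5 (p. 3), Rem. 6.2 (p. 15); [MatarNekovar2019] Thm. 0.3,
§0.11; [MilneADT2006] Thm. I.7.3, Rem. I.7.4; [Kato2004Asterisque] Thm. 14.5 (3); [CoatesSujatha2005] Conj. A;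
[BurungaleFlach2024] Cor. 2; [SerreAbelianLadic1968] IV-23 Lemma 3; [CremonaAlgorithms1997] §3.9;
[PastenShimura2024] §2; [SilvermanATAEC1994] IV.9.4; [Miller2011LMS] Def. 1.1.
-/

set_option autoImplicit false
-- the Theorems directory repeats the summit name (sibling precedent `KatoDescentPotSupersingularAssembly.lean`)
set_option linter.dupNamespace false

noncomputable section

open scoped Classical NumberField

namespace Summit.BirchSwinnertonDyer.BirchSwinnertonDyer.Theorems.TameUpperOptimalSharpNodes

open WeierstrassCurve IsDedekindDomain IsDedekindDomain.HeightOneSpectrum NumberField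
  Rat.HeightOneSpectrum Literature.NumberTheory.EllipticCurves
  Literature.NumberTheory.EllipticCurves.ModularForms
  Literature.NumberTheory.DiophantineGeometry
  Literature.NumberTheory.EllipticCurves.Rank1Residual
  Literature.NumberTheory.EllipticCurves.Rank1Residual.Typed
  Literature.NumberTheory.Automorphic Literature.NumberTheory.EllipticCurves.KrizLi2019
  Literature.NumberTheory.QuadraticFields
  Summit.BirchSwinnertonDyer.Rank1Residual
  Summit.BirchSwinnertonDyer.Rank1Residual.Additive
  Summit.BirchSwinnertonDyer.BirchSwinnertonDyer.Theorems
  Summit.BirchSwinnertonDyer.BirchSwinnertonDyer.Theorems.TameUpperHeegnerSharpRoad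
  Summit.BirchSwinnertonDyer.BirchSwinnertonDyer.Theorems.TameUpperOptimalSharpRoad

/-! ### §1 Private re-homings (the twist of a (t′) row; CM rows; the fine-Selmer port; rationality) -/

/-- **The Heegner twist of a (t′) row is a (t′) row** (private verbatim re-homing of g2's public
`Theorems.subTprime_twist_of_heegner`, whose module imports the route file): for `W` globally minimal,
additive of type (t′) at `p`, `K` imaginary quadratic of ODD discriminant with the Heegner hypothesis for
`N_E`, every globally minimal model of `E^{(d_K)}` is additive of type (t′) at `p`.
[folklore] [cite: SilvermanATAEC1994, IV.9.4 (PDF pp. 344–346)] [cite: Serre1973, Ch. II §3.3 Thm. 3] -/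
private theorem subTprime_twist_of_heegner (W : WeierstrassCurve ℚ) [W.IsElliptic] [W.IsGloballyMinimal]
    (p : ℕ) [Fact p.Prime] (hadd : Addv W p) (hT : SubTprime W p)
    (K : Type) [Field K] [NumberField K] (hK : IsImaginaryQuadratic K)
    (hHN : SatisfiesHeegnerHypothesis (W.conductorNorm ℤ) K) (hodd : Odd (NumberField.discr K))
    (Wd : WeierstrassCurve ℚ) [Wd.IsElliptic] [Wd.IsGloballyMinimal] (Cd : VariableChange ℚ)
    (hWd : Cd • W.quadraticTwist (NumberField.discr K : ℚ) = Wd) :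
    Addv Wd p ∧ SubTprime Wd p := by
  have hp : p.Prime := Fact.out
  have hD0 : (NumberField.discr K : ℚ) ≠ 0 := by exact_mod_cast NumberField.discr_ne_zero K
  have hpN : p ∣ W.conductorNorm ℤ :=
    (W.dvd_conductorNorm_iff_not_hasGoodReductionAtPrime p).mpr (not_good_of_addv W p hadd)
  have hsq' : IsSquare (algebraMap ℚ ℚ_[p] (NumberField.discr K : ℚ)) :=
    X11b.isSquare_discr_padic_of_heegner K hK hHN p hpN
  have hsq : IsSquare (((NumberField.discr K : ℚ) : ℚ) : ℚ_[p]) := by simpa using hsq'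
  have hj : Wd.j = W.j := AdditivePotMult.j_of_model_twist (W := W) hD0 ⟨Cd, hWd⟩
  have haddv : Addv Wd p := (AdditivePotMult.addv_iff_of_twist (W := W) hD0 hsq Wd hWd).mpr hadd
  have hpd : ¬ ((p : ℕ) : ℤ) ∣ NumberField.discr K :=
    Literature.SatisfiesHeegnerHypothesis.not_dvd_discr hK.1 hHN hp hpN
  have hd4 : NumberField.discr K % 4 = 1 :=
    Literature.NumberTheory.QuadraticFields.Quadratic.discr_emod_four_eq_one hK.1 hodd
  have hf : condExp Wd p = condExp W p := by
    unfold condExp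
    refine conductorExponent_eq_of_model_twist_of_not_dvd W Wd hd4 Cd hWd (placeOf p) ?_
    rw [natGenerator_placeOf_eq]
    exact hpd
  have hu : padicValRat p (Cd.u : ℚ) = 0 :=
    AdditivePotMult.padicValRat_u_eq_zero_of_twist_minimal_of_dvd W p K hK hHN hpN Cd hWd
  have hΔ : padicValRat p Wd.Δ = padicValRat p W.Δ := by
    haveI := W.isElliptic_quadraticTwist hD0
    have hu0 : ((Cd.u⁻¹ : ℚˣ) : ℚ) ≠ 0 := (Cd.u⁻¹).ne_zero
    have hΔ0 : W.Δ ≠ 0 := W.isUnit_Δ.ne_zero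
    have hd6 : (NumberField.discr K : ℚ) ^ 6 ≠ 0 := pow_ne_zero 6 hD0
    have hdv : padicValRat p (NumberField.discr K : ℚ) = 0 := by
      rw [padicValRat.of_int, padicValInt.eq_zero_of_not_dvd hpd, Nat.cast_zero]
    have huv : padicValRat p ((Cd.u⁻¹ : ℚˣ) : ℚ) = 0 := by
      rw [Units.val_inv_eq_inv_val, padicValRat.inv, hu, neg_zero]
    rw [← hWd, variableChange_Δ, quadraticTwist_Δ, padicValRat.mul (pow_ne_zero 12 hu0)
      (mul_ne_zero hd6 hΔ0), padicValRat.mul hd6 hΔ0, padicValRat.pow, padicValRat.pow, huv, hdv]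
    ring
  refine ⟨haddv, ?_, ?_, ?_⟩
  · unfold PotMult; rw [hj]; exact hT.1
  · unfold CondExpTwo; rw [hf]; exact hT.2.1
  · rw [semistabilityIndex_dvd_iff Wd p, ← twelve_dvd_padicValRat_Δ_iff Wd p, hΔ,
      twelve_dvd_padicValRat_Δ_iff W p, ← semistabilityIndex_dvd_iff W p]
    exact hT.2.2

/-- **CM rows of analytic rank `0` have the upper half at every prime** (Burungale–Flach 2024 Cor. 2 via
row C8 `bsdp_cm_rankZero`; private re-homing). [cite: BurungaleFlach2024, Thm. 1.1 and Cor. 2 (p. 4)]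
[cite: Miller2011LMS, §1 and Def. 1.1] -/
private theorem missingUpperBoundAt_of_hasCM_rankZero (hCM : bsdTriple_of_hasCM_of_L_one_ne_zero)
    (hmod : hasEntireLFunction_rat) (hGZK : rank_eq_analyticRank_of_analyticRank_le_one)
    (W : WeierstrassCurve ℚ) [W.IsElliptic] [W.IsGloballyMinimal] (p : ℕ) [Fact p.Prime]
    (hr : W.analyticRank = 0) (hcm : W.HasCM) : MissingUpperBoundAt W p := by
  haveI : Finite W.sha := (hGZK W (by omega)).2
  exact (lower_and_upper_of_missingPPartAt W p
    (missingPPartAt_of_bsdp W p (bsdp_cm_rankZero hCM hmod hcm hr))).2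

/-- **The fine-Selmer port of Kato 14.5 (3) on an irreducible rank-`0` (t′) row** (private re-homing of g0's
`Theorems.missingUpperBoundAt_tame_of_irreducible_of_fineSelmerDual_fg`, whose module imports the route): at an
odd additive potentially good `p` with `E[p]` irreducible and `Y(E/ℚ^cyc)` finitely generated over `ℤ_p` (`hA`),
the upper half (`ord_p #Ш + v_p ∏c_ℓ ≤ ord_p (L/Ω)`, `#Ш_an = (L/Ω)·#tors²/∏c_ℓ`, torsion term killed by
irreducibility). [cite: Kato2004Asterisque, Thm. 14.5 (3) (p. 236), Thm. 12.5 (3) (p. 222), 14.14 (p. 243)]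
[cite: Lim2017FineSelmer, §3] [cite: Miller2011LMS, Def. 1.1] -/
private theorem missingUpperBoundAt_tame_of_irreducible_of_fineSelmerDual_fg
    (hKatoA :
      Kato2004.rankZero_padicValNat_sha_add_padicValNat_tamagawa_le_of_additive_potGood_of_irreducible_of_fineSelmerDual_fg)
    (hGZK : rank_eq_analyticRank_of_analyticRank_le_one) (hmod : hasEntireLFunction_rat)
    (W : WeierstrassCurve ℚ) [W.IsElliptic] [W.IsGloballyMinimal] (p : ℕ) [Fact p.Prime]
    (hr : W.analyticRank = 0) (hp2 : p ≠ 2) (hadd : Addv W p) (hT : SubTprime W p)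
    (hirr : W.HasIrreducibleModPGaloisRep p)
    (hA : ∀ (κ : ZpExtension ℚ p), κ.IsCyclotomic →
      ∃ (γ : Field.absoluteGaloisGroup ℚ) (D : W.FineSelmerDualData κ γ),
        Module.Finite ℤ_[p] (RestrictScalars ℤ_[p] (IwasawaAlgebra p) D.X)) :
    MissingUpperBoundAt W p := by
  have hO5 : ClassO5 W p := ⟨hp2, hadd, Or.inr hT⟩
  have hL : W.entireLFunction 1 ≠ 0 := (W.analyticRank_eq_zero_iff_holds (hmod W)).mp hr
  obtain ⟨hmw, hfin⟩ := hGZK W (by rw [hr]; exact zero_le_one)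
  haveI : Finite W.sha := hfin
  have hmw0 : W.mordellWeilRank = 0 := by rw [hmw, hr]
  obtain ⟨q₀, hq₀, hle⟩ := hKatoA W p hp2 hadd.1 hadd.2 hO5.padicValRat_j_nonneg hirr hA hL hfin
  have hΩpos : 0 < W.realPeriodRat := W.realPeriodRat_pos_holds
  have hΩ : (W.realPeriodRat : ℂ) ≠ 0 := by exact_mod_cast hΩpos.ne'
  have hc0 : 0 < W.tamagawaProduct := W.tamagawaProduct_pos_holds
  have ht0 : 0 < W.torsionOrder := W.torsionOrder_pos_holds
  have hq₀0 : q₀ ≠ 0 := by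
    rintro rfl
    rw [Rat.cast_zero, div_eq_zero_iff] at hq₀
    exact hq₀.elim hL hΩ
  refine ⟨q₀ * (W.torsionOrder : ℚ) ^ 2 / (W.tamagawaProduct : ℚ), ?_, ?_⟩
  · have hLq : W.entireLFunction 1 = (q₀ : ℂ) * (W.realPeriodRat : ℂ) := by
      rw [← hq₀, div_mul_cancel₀ _ hΩ]
    rw [shaAn_def, W.leadingLCoeff_eq_of_analyticRank_eq_zero hr,
      W.regulator_eq_one_of_rank_zero hmw0, hLq]
    push_cast
    field_simp
  · have ht : (W.torsionOrder : ℚ) ≠ 0 := by exact_mod_cast ht0.ne'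
    have hcq : (W.tamagawaProduct : ℚ) ≠ 0 := by exact_mod_cast hc0.ne'
    have hsha : padicValNat p (Nat.card (AddCommGroup.primaryComponent W.sha p)) =
        padicValNat p W.shaOrder := by
      unfold WeierstrassCurve.shaOrder
      exact padicValNat_card_addPrimaryComponent p
    have htors : (padicValNat p W.torsionOrder : ℤ) = 0 := by
      exact_mod_cast padicValNat_torsionOrder_eq_zero_of_irreducible W p hirr
    have hv : padicValRat p (q₀ * (W.torsionOrder : ℚ) ^ 2 / (W.tamagawaProduct : ℚ)) =
        padicValRat p q₀ + 2 * (padicValNat p W.torsionOrder : ℤ) -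
          (padicValNat p W.tamagawaProduct : ℤ) := by
      rw [padicValRat.div (mul_ne_zero hq₀0 (pow_ne_zero 2 ht)) hcq,
        padicValRat.mul hq₀0 (pow_ne_zero 2 ht), pow_two, padicValRat.mul ht ht,
        padicValRat.of_nat, padicValRat.of_nat]
      ring
    rw [hv, ← hsha, htors]
    linarith

/-- **Rationality of `L(E,1)/Ω_E` from the rationality of `#Ш(E)_an` in analytic rank `0`**
(`L(E,1)/Ω = #Ш_an · ∏c_ℓ / #E(ℚ)_tors²`, `Reg = 1` by GZK; private re-homing). [cite: Miller2011LMS, Def. 1.1] -/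
private theorem exists_ratio_rat_of_shaAn_rat_rankZero (hGZK : rank_eq_analyticRank_of_analyticRank_le_one)
    (W : WeierstrassCurve ℚ) [W.IsElliptic] (hr : W.analyticRank = 0) {q : ℚ}
    (hq : shaAn W = (q : ℂ)) :
    ∃ q0 : ℚ, W.entireLFunction 1 / (W.realPeriodRat : ℂ) = (q0 : ℂ) := by
  have hmw0 : W.mordellWeilRank = 0 := by rw [(hGZK W (by rw [hr]; exact zero_le_one)).1, hr]
  have hΩ : (W.realPeriodRat : ℂ) ≠ 0 := by exact_mod_cast W.realPeriodRat_pos_holds.ne'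
  have ht : (W.torsionOrder : ℂ) ≠ 0 := by exact_mod_cast W.torsionOrder_pos_holds.ne'
  have hc : (W.tamagawaProduct : ℂ) ≠ 0 := by exact_mod_cast W.tamagawaProduct_pos_holds.ne'
  rw [shaAn_def, W.leadingLCoeff_eq_of_analyticRank_eq_zero hr, W.regulator_eq_one_of_rank_zero hmw0]
    at hq
  simp only [Complex.ofReal_one, mul_one] at hq
  refine ⟨q * W.tamagawaProduct / (W.torsionOrder : ℚ) ^ 2, ?_⟩
  push_cast
  rw [← hq]
  field_simp

/-! ### §2 The BODY of the U₀-ns node `TameUpperNonsurjTower` through the optimal member of the class -/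

/-- **The BODY of the U₀-ns node `TameUpperNonsurjTower` (item 19202) from: the JETCHEV IRREDUCIBLE READING
`hJr` (displayed schema in the vocabulary of `Jetchev2008.cor15_padicValNat_card_primaryComponent_sha_le`:
optimal datum with `p ∤ c`, `p`-primary `Ш`, ONE Tamagawa prime `q ≠ p`; additive potentially good `p`, `E[p]`
irreducible, `ρ̄` not onto — NOT a theorem of the tree, NOT asserted), the Heegner-road published facts
(Gross–Zagier, Kolyvagin, Matar–Nekovář, newforms, Bump–Friedberg–Hoffstein) and CASSELS' isogeny invariance,
COATES–SUJATHA'S (A) ONLY ON THE RESIDUE ROWS (`hCS`: the class has an optimal member `W₀`, lattice-optimal datum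
`D₀` at `N_E`, with `p ∣ c(D₀)` or with the `p`-part of `∏c_ℓ(W₀)` carried by no single bad prime `q ≠ p`), and
the BODIES of L₀ (19981), of the residual `TameRankOne` (19984), of `KatoTamagawaExactInputs` (19191; A161″
unused) and of `PublishedInputsFineSelmerCM` (19387).** Rows: CM → Burungale–Flach; `ρ̄` onto → void (tame
tower at `3`, Serre at `p ≥ 5`); residue → the fine-Selmer port + (A) at `W`; otherwise §2 at the OPTIMAL member
`W₀` (`X12.exists_isIsogenous_optimal`; `r_an`, additivity, irreducibility, non-surjectivity transported along
the isogeny; rationality and the twists' lower halves carried from `W` by Cassels; the result carried back by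
Cassels). No (t′)-transport along the isogeny is used (so `p = 3` is covered). Conditional; nothing asserted;
NO item is closed; BSD is not proved by any of this.
[cite: Jetchev2008, Hypothesis (*), Thm. 1.4, Cor. 1.5 (p. 3), Rem. 6.2 (p. 15)] [cite: MatarNekovar2019, Thm. 0.3 (p. 456), §0.11 (p. 457)]
[cite: MilneADT2006, Thm. I.7.3 and Remark I.7.4] [cite: Kato2004Asterisque, Thm. 14.5 (3) (p. 236)]
[cite: CoatesSujatha2005, Conjecture A] [cite: BurungaleFlach2024, Thm. 1.1 and Cor. 2 (p. 4)]
[cite: SerreAbelianLadic1968, Ch. IV §3.4 Lemma 3 (IV-23)] [cite: CremonaAlgorithms1997, §3.9 (p. 87)]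
[cite: PastenShimura2024, §2 p. 12] -/
theorem upperNonsurjTower_of_jetchevReading_of_cruxAResidue
    (hJr : ∀ (N : ℕ) [NeZero N] (W : WeierstrassCurve ℚ) [W.IsElliptic] [W.IsGloballyMinimal]
      (K : Type) [Field K] [NumberField K],
      IsImaginaryQuadratic K → NumberField.discr K ≠ -3 → SatisfiesHeegnerHypothesis N K →
      ∀ (p : ℕ) [Fact p.Prime], p ≠ 2 → W.analyticRank = 0 → Addv W p → 0 ≤ padicValRat p W.j →
      ¬ W.HasCM → W.HasIrreducibleModPGaloisRep p → ¬ W.HasSurjectiveModNGaloisRep p →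
      (∃ Dt : ModularParametrizationData W N,
        (∀ z ∈ Dt.L.lattice, ∃ w ∈ periodLattice Dt.f, z = (Dt.c : ℂ) * w) ∧ ¬ (p : ℤ) ∣ Dt.c) →
      ∀ {P : (W.baseChange K).toAffine.Point}, IsHeegnerPoint N W K P → ¬ IsOfFinAddOrder P →
      ∀ (q : ℕ) [Fact q.Prime], q ∣ N → q ≠ p →
      padicValNat p (Nat.card (AddCommGroup.primaryComponent (W.baseChange K).sha p)) +
          2 * padicValNat p ((W.baseChange ℚ_[q]).localTamagawaNumber ℤ_[q]) ≤
        2 * padicValNat p (AddSubgroup.zmultiples P).index)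
    (hGZ : ∀ (N : ℕ) [NeZero N] (W : WeierstrassCurve ℚ) (K : Type) [Field K] [NumberField K],
      gross_zagier N W K)
    (hKo : ∀ (N : ℕ) [NeZero N] (W : WeierstrassCurve ℚ) (K : Type) [Field K] [NumberField K],
      kolyvagin N W K)
    (hMN : ∀ (N : ℕ) [NeZero N] (W : WeierstrassCurve ℚ) (K : Type) [Field K] [NumberField K],
      MatarNekovar2019.thm03_padicValNat_card_sha_le_of_irreducible N W K)
    (hnf : exists_isNewformOf) (hBFH : bumpFriedbergHoffstein_exists_heegnerField_split_twist_simpleZero)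
    (hCassels : bsdRHS_eq_of_isIsogenous)
    (hCS : ∀ (W : WeierstrassCurve ℚ) [W.IsElliptic] [W.IsGloballyMinimal] (p : ℕ) [Fact p.Prime],
      W.analyticRank = 0 → p ≠ 2 → Addv W p → SubTprime W p → ¬ W.HasCM →
      W.HasIrreducibleModPGaloisRep p → ¬ W.HasSurjectiveModNGaloisRep p →
      (∃ (W₀ : WeierstrassCurve ℚ) (_ : W₀.IsElliptic) (_ : W₀.IsGloballyMinimal)
          (_ : NeZero (W₀.conductorNorm ℤ)) (D₀ : ModularParametrizationData W₀ (W₀.conductorNorm ℤ)),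
        IsIsogenous W W₀ ∧ (∀ z ∈ D₀.L.lattice, ∃ w ∈ periodLattice D₀.f, z = (D₀.c : ℂ) * w) ∧
        ((p : ℤ) ∣ D₀.c ∨ (p ∣ W₀.tamagawaProduct ∧
          ¬ ∃ (q : ℕ) (_ : Fact q.Prime), q ∣ W₀.conductorNorm ℤ ∧ q ≠ p ∧
            padicValNat p W₀.tamagawaProduct ≤
              padicValNat p ((W₀.baseChange ℚ_[q]).localTamagawaNumber ℤ_[q])))) →
      ∀ (κ : ZpExtension ℚ p), κ.IsCyclotomic →
        ∃ (γ : Field.absoluteGaloisGroup ℚ) (D : W.FineSelmerDualData κ γ),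
          Module.Finite ℤ_[p] (RestrictScalars ℤ_[p] (IwasawaAlgebra p) D.X))
    (h₂ : ∀ (W : WeierstrassCurve ℚ) [W.IsElliptic] [W.IsGloballyMinimal] (p : ℕ) [Fact p.Prime],
      W.analyticRank = 0 → p ≠ 2 → Addv W p → SubTprime W p → MissingLowerBoundAt W p)
    (hR : ∀ (W : WeierstrassCurve ℚ) [W.IsElliptic] [W.IsGloballyMinimal] (p : ℕ) [Fact p.Prime],
      W.analyticRank = 1 → p ≠ 2 → Addv W p → SubTprime W p → MissingPPartAt W p)
    (hK : Kato2004.rankZero_padicValNat_sha_add_padicValNat_tamagawa_le_of_additive_potGood_of_imageContainsSL2 ∧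
      rank_eq_analyticRank_of_analyticRank_le_one ∧ WeierstrassCurve.hasEntireLFunction_rat)
    (hF : Kato2004.rankZero_padicValNat_sha_add_padicValNat_tamagawa_le_of_additive_potGood_of_irreducible_of_fineSelmerDual_fg ∧
      bsdTriple_of_hasCM_of_L_one_ne_zero) :
    ∀ (W : WeierstrassCurve ℚ) [W.IsElliptic] [W.IsGloballyMinimal] (p : ℕ) [Fact p.Prime],
      W.analyticRank = 0 → p ≠ 2 → Addv W p → SubTprime W p → W.HasIrreducibleModPGaloisRep p →
      ¬ (∀ n : ℕ, W.HasSurjectiveModNGaloisRep (p ^ n : ℕ)) → MissingUpperBoundAt W p := by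
  obtain ⟨-, hGZK, hmod⟩ := hK
  intro W _ _ p _ hr hp2 hadd hT hI hnsT
  haveI : NeZero (W.conductorNorm ℤ) := ⟨(conductorNorm_pos_holds W).ne'⟩
  have hp : p.Prime := Fact.out
  -- CM rows: Burungale–Flach
  by_cases hcm : W.HasCM
  · exact missingUpperBoundAt_of_hasCM_rankZero hF.2 hmod hGZK W p hr hcm
  -- `ρ̄_{E,p}` onto is void on these rows (the tower would be onto)
  by_cases hsp : W.HasSurjectiveModNGaloisRep p
  · by_cases h3 : p = 3
    · subst h3
      exact absurd (ClassX4.towerSurj_three_of_surj_of_subTprime ⟨by decide, hadd, hI⟩ hT hsp) hnsT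
    · exact absurd (serre_hasSurjectiveModNGaloisRep_pow_holds W p
        (hp.five_le_of_ne_two_of_ne_three hp2 h3) hsp) hnsT
  -- the optimal member of the class and its lattice-optimal datum (Modularity)
  obtain ⟨W₀, hE₀, hM₀, hNZ₀, D₀, hiso, hN, hopt⟩ := X12.exists_isIsogenous_optimal hnf W
  -- the residue rows: the fine-Selmer port + (A) at `W`
  by_cases hres : (p : ℤ) ∣ D₀.c ∨ (p ∣ W₀.tamagawaProduct ∧
      ¬ ∃ (q : ℕ) (_ : Fact q.Prime), q ∣ W₀.conductorNorm ℤ ∧ q ≠ p ∧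
        padicValNat p W₀.tamagawaProduct ≤ padicValNat p ((W₀.baseChange ℚ_[q]).localTamagawaNumber ℤ_[q]))
  · exact missingUpperBoundAt_tame_of_irreducible_of_fineSelmerDual_fg hF.1 hGZK hmod W p hr hp2 hadd hT hI
      (hCS W p hr hp2 hadd hT hcm hI hsp ⟨W₀, hE₀, hM₀, hNZ₀, D₀, hiso, hopt, hres⟩)
  have hc₀ : ¬ (p : ℤ) ∣ D₀.c := fun h ↦ hres (Or.inl h)
  have hsingle₀ : p ∣ W₀.tamagawaProduct → ∃ (q : ℕ) (_ : Fact q.Prime), q ∣ W₀.conductorNorm ℤ ∧ q ≠ p ∧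
      padicValNat p W₀.tamagawaProduct ≤ padicValNat p ((W₀.baseChange ℚ_[q]).localTamagawaNumber ℤ_[q]) := by
    intro ht
    by_contra hne
    exact hres (Or.inr ⟨ht, hne⟩)
  -- transports along `W ∼ W₀`: analytic rank, additivity with integral `j`, the mod-`p` image
  have hr₀ : W₀.analyticRank = 0 := by rw [← analyticRank_eq_of_isIsogenous' hiso]; exact hr
  have hj : 0 ≤ padicValRat p W.j := not_lt.mp hT.1
  obtain ⟨hadd₀, hj₀⟩ := Addv.of_isIsogenous_of_padicValRat_j_nonneg (p := p) hadd hj hiso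
  obtain ⟨e, he⟩ :=
    Summit.BirchSwinnertonDyer.BirchSwinnertonDyer.Rank1Residual.exists_torsionIso_of_isIsogenous_of_irreducible
      (p := p) hI hiso
  obtain ⟨hI₀, hns₀⟩ := GaloisImage.irr_and_not_surj_of_torsionIso e he hI hsp
  have hcm₀ : ¬ W₀.HasCM := fun h ↦ hcm ((X12.hasCM_iff_of_isIsogenous hiso).mpr h)
  -- rationality of `L(E₀,1)/Ω`: `#Ш_an(E) ∈ ℚ` from the L₀ body at `W`, moved by Cassels
  obtain ⟨q, hq, -⟩ := h₂ W p hr hp2 hadd hT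
  have hfinW : Finite W.sha := (hGZK W (by rw [hr]; exact zero_le_one)).2
  have hleadW : W.leadingLCoeff ≠ 0 := W.leadingLCoeff_ne_zero_holds (hmod W)
  obtain ⟨q', hq', -⟩ := X12.exists_shaAn_eq_of_isIsogenous hCassels hiso.symm_of_charZero hfinW hleadW p hq
  have hrat₀ := exists_ratio_rat_of_shaAn_rat_rankZero hGZK W₀ hr₀ hq'
  -- the twists' lower halves: `TameRankOne` at the minimal model of `E^{(d_K)}` ((t′), §1), moved by Cassels
  have hlow₀ : ∀ (K : Type) [Field K] [NumberField K], IsImaginaryQuadratic K →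
      SatisfiesHeegnerHypothesis (W₀.conductorNorm ℤ) K → Odd (NumberField.discr K) →
      ∀ (Wd : WeierstrassCurve ℚ) [Wd.IsElliptic] [Wd.IsGloballyMinimal] (Cd : VariableChange ℚ),
        Cd • W₀.quadraticTwist (NumberField.discr K : ℚ) = Wd → Wd.analyticRank = 1 →
        MissingLowerBoundAt Wd p := by
    intro K _ _ hKq hHN₀ hodd Wd₀ _ _ Cd₀ hWd₀ hrd₀
    have hHN : SatisfiesHeegnerHypothesis (W.conductorNorm ℤ) K := by rw [← hN]; exact hHN₀
    have hD0 : (NumberField.discr K : ℚ) ≠ 0 := by exact_mod_cast NumberField.discr_ne_zero K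
    haveI : (W.quadraticTwist (NumberField.discr K : ℚ)).IsElliptic := W.isElliptic_quadraticTwist hD0
    haveI : (W₀.quadraticTwist (NumberField.discr K : ℚ)).IsElliptic := W₀.isElliptic_quadraticTwist hD0
    obtain ⟨Cd, hCd⟩ := hasGlobalMinimalModel_rat_holds (W.quadraticTwist (NumberField.discr K : ℚ))
    haveI : (Cd • W.quadraticTwist (NumberField.discr K : ℚ)).IsGloballyMinimal := hCd
    obtain ⟨haddd, hTd⟩ := subTprime_twist_of_heegner W p hadd hT K hKq hHN hodd
      (Cd • W.quadraticTwist (NumberField.discr K : ℚ)) Cd rfl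
    -- the two twist models are `ℚ`-isogenous
    haveI : NeZero (2 : ℚ) := ⟨two_ne_zero⟩
    have hisoT : IsIsogenous (Cd • W.quadraticTwist (NumberField.discr K : ℚ)) Wd₀ := by
      rw [← hWd₀]
      exact IsIsogenous.trans' (IsIsogenous.trans' (isIsogenous_of_smul _ Cd) (hiso.quadraticTwist hD0))
        (isIsogenous_smul _ Cd₀)
    have hrd : (Cd • W.quadraticTwist (NumberField.discr K : ℚ)).analyticRank = 1 := by
      rw [analyticRank_eq_of_isIsogenous' hisoT]; exact hrd₀
    have hlowd : MissingLowerBoundAt (Cd • W.quadraticTwist (NumberField.discr K : ℚ)) p :=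
      (lower_and_upper_of_missingPPartAt _ p (hR _ p hrd hp2 haddd hTd)).1
    have hfind : Finite (Cd • W.quadraticTwist (NumberField.discr K : ℚ)).sha :=
      (hGZK _ (by rw [hrd])).2
    have hleadd : (Cd • W.quadraticTwist (NumberField.discr K : ℚ)).leadingLCoeff ≠ 0 :=
      (Cd • W.quadraticTwist (NumberField.discr K : ℚ)).leadingLCoeff_ne_zero_holds (hmod _)
    exact X12.missingLowerBoundAt_of_isIsogenous hCassels hisoT.symm_of_charZero hfind hleadd hlowd
  -- the upper half at the optimal member, then back to `W` by Cassels
  have hup₀ : MissingUpperBoundAt W₀ p :=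
    missingUpperBoundAt_rankZero_of_optimalDatum_of_jetchevReading hGZ hKo hMN hGZK hmod hnf hBFH hJr W₀ p hr₀
      hp2 hadd₀ hj₀ hcm₀ hI₀ hns₀ D₀ hopt hc₀ hsingle₀ hrat₀ hlow₀
  have hfin₀ : Finite W₀.sha := (hGZK W₀ (by rw [hr₀]; exact zero_le_one)).2
  have hlead₀ : W₀.leadingLCoeff ≠ 0 := W₀.leadingLCoeff_ne_zero_holds (hmod W₀)
  exact X12.missingUpperBoundAt_of_isIsogenous hCassels hiso hfin₀ hlead₀ hup₀

end Summit.BirchSwinnertonDyer.BirchSwinnertonDyer.Theorems.TameUpperOptimalSharpNodes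

end
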